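import Summits.PneNP.PneNP.Theorems.ConvexRankGatesConvexGateBlindXorDefs

/-!
# Rank corner of `ExactLifting` — core: one-bit flips, the character of three bits, the dual family

Support file for crux `ConvexGateBlind` (stmt-PneNP-10680), line `xor-door-perfect-completeness`, open stub
`stub_exactLifting : XorDoor.ExactLifting` (lead c3). This is the combinatorial core used by
`ConvexRankGatesConvexGateBlindExactLiftingRankCorner.lean` (`exactLifting_rank_corner`: `t³ ≤ q² + r` for every
cone factorisation of every real shift of the Index-lift of a fooled system):

* §1 `flipAt` (flip one bit of a string table), an involution, and `sum_mul_eq_zero_of_flip` (a sign-reversing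
  weight kills flip-invariant functions);
* §2 the parity `par` / character `chi` of the three bits `(i, w₀ i), (j, w₀ j), (l, w₀ l)`;
* §3 the columns `col F ε w : x ↦ viol_F(x[w]) − ε` of the shifted lift, the functional
  `Lam w₀ f = Σ_x chi(x) f(x)`, and OFF-DIAGONAL VANISHING `Lam_col_eq_zero` (pointers disagreeing on `i, j, l`);
* §4 DIAGONAL NON-VANISHING `Lam_col_self_ne_zero` when `F` has an equation exactly on `{i,j,l}` and all such
  equations share their right-hand side (every real `ε`);
* §5 the pointers `ptrOf` through a triple; §6 the registered def-free form `character_dual_family`.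
Elementary; no citation needed.
-/

set_option linter.dupNamespace false -- `Summit.PneNP.PneNP.…`: summit = sub-problem (D-0017)

namespace Summit.PneNP.PneNP.Theorems.XorDoor.RankCorner

open scoped BigOperators Classical
open Finset

noncomputable section

variable {m t : ℕ}

/-! ## §1 Flipping one bit of a string table -/

/-- Flip the bit at position `k` of block `a` of the string table `x`. -/
def flipAt (a : Fin m) (k : Fin t) (x : Fin m → Fin t → ZMod 2) : Fin m → Fin t → ZMod 2 :=
  fun a' k' => if a' = a ∧ k' = k then x a' k' + 1 else x a' k'

/-- Reading a flipped table through a pointer. -/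
theorem flipAt_read (a : Fin m) (k : Fin t) (x : Fin m → Fin t → ZMod 2) (b : Fin m)
    (w : Fin m → Fin t) :
    flipAt a k x b (w b) = x b (w b) + if (b = a ∧ w b = k) then 1 else 0 := by
  unfold flipAt
  split_ifs <;> simp

/-- Every element of `𝔽₂` is `0` or `1`. -/
theorem zmod2_cases : ∀ p : ZMod 2, p = 0 ∨ p = 1 := by decide

/-- Flipping twice is the identity. -/
theorem flipAt_flipAt (a : Fin m) (k : Fin t) (x : Fin m → Fin t → ZMod 2) :
    flipAt a k (flipAt a k x) = x := by
  funext a' k'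
  unfold flipAt
  have h11 : (1 : ZMod 2) + 1 = 0 := by decide
  by_cases h : a' = a ∧ k' = k
  · rw [if_pos h, if_pos h, add_assoc, h11, add_zero]
  · rw [if_neg h, if_neg h]

/-- The flip as an equivalence of the row index type. -/
def flipEquiv (a : Fin m) (k : Fin t) : (Fin m → Fin t → ZMod 2) ≃ (Fin m → Fin t → ZMod 2) :=
  ⟨flipAt a k, flipAt a k, flipAt_flipAt a k, flipAt_flipAt a k⟩

/-- A weight that reverses sign under a flip kills every flip-invariant function. -/
theorem sum_mul_eq_zero_of_flip (a : Fin m) (k : Fin t) (χ g : (Fin m → Fin t → ZMod 2) → ℝ)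
    (hχ : ∀ x, χ (flipAt a k x) = -χ x) (hg : ∀ x, g (flipAt a k x) = g x) :
    ∑ x, χ x * g x = 0 := by
  have h : ∑ x, χ (flipAt a k x) * g (flipAt a k x) = ∑ x, χ x * g x :=
    Equiv.sum_comp (flipEquiv a k) (fun x => χ x * g x)
  simp only [hχ, hg, neg_mul, Finset.sum_neg_distrib] at h
  linarith

/-! ## §2 The character of three selected bits -/

/-- Parity of the three bits of `x` selected by the pointer `w₀` in blocks `i, j, l`. -/
def par (i j l : Fin m) (w₀ : Fin m → Fin t) (x : Fin m → Fin t → ZMod 2) : ZMod 2 :=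
  x i (w₀ i) + x j (w₀ j) + x l (w₀ l)

/-- The `±1` character of those three bits. -/
def chi (i j l : Fin m) (w₀ : Fin m → Fin t) (x : Fin m → Fin t → ZMod 2) : ℝ :=
  if par i j l w₀ x = 0 then 1 else -1

/-- Flipping one of the three selected bits adds `1` to the parity (the three blocks are distinct). -/
theorem par_flip {i j l : Fin m} (hij : i ≠ j) (hil : i ≠ l) (hjl : j ≠ l) (w₀ : Fin m → Fin t)
    {a : Fin m} (ha : a = i ∨ a = j ∨ a = l) (x : Fin m → Fin t → ZMod 2) :
    par i j l w₀ (flipAt a (w₀ a) x) = par i j l w₀ x + 1 := by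
  unfold par
  rw [flipAt_read, flipAt_read, flipAt_read]
  rcases ha with rfl | rfl | rfl
  · rw [if_pos ⟨rfl, rfl⟩, if_neg (fun h => hij h.1.symm), if_neg (fun h => hil h.1.symm)]
    ring
  · rw [if_neg (fun h => hij h.1), if_pos ⟨rfl, rfl⟩, if_neg (fun h => hjl h.1.symm)]
    ring
  · rw [if_neg (fun h => hil h.1), if_neg (fun h => hjl h.1), if_pos ⟨rfl, rfl⟩]
    ring

/-- Hence the character reverses sign. -/
theorem chi_flip {i j l : Fin m} (hij : i ≠ j) (hil : i ≠ l) (hjl : j ≠ l) (w₀ : Fin m → Fin t)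
    {a : Fin m} (ha : a = i ∨ a = j ∨ a = l) (x : Fin m → Fin t → ZMod 2) :
    chi i j l w₀ (flipAt a (w₀ a) x) = -chi i j l w₀ x := by
  unfold chi
  rw [par_flip hij hil hjl w₀ ha x]
  have h11 : (1 : ZMod 2) + 1 = 0 := by decide
  rcases zmod2_cases (par i j l w₀ x) with h | h
  · simp [h]
  · simp [h, h11]

/-- The character has zero sum. -/
theorem sum_chi_eq_zero {i j l : Fin m} (hij : i ≠ j) (hil : i ≠ l) (hjl : j ≠ l)
    (w₀ : Fin m → Fin t) : ∑ x, chi i j l w₀ x = 0 := by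
  have := sum_mul_eq_zero_of_flip i (w₀ i) (chi i j l w₀) (fun _ => (1 : ℝ))
    (chi_flip hij hil hjl w₀ (Or.inl rfl)) (fun _ => rfl)
  simpa using this

/-! ## §3 Columns of the shifted lift and the character functional -/

/-- Column `w` of the shifted lift, as a real function of the string table. -/
def col (F : Finset (Pool m)) (ε : ℝ) (w : Fin m → Fin t) (x : Fin m → Fin t → ZMod 2) : ℝ :=
  (viol F (fun i => x i (w i)) : ℝ) - ε

/-- Violation indicator of the equation `e` read through the pointer `w`. -/
def vInd (e : Pool m) (w : Fin m → Fin t) (x : Fin m → Fin t → ZMod 2) : ℝ :=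
  if x e.1 (w e.1) + x e.2.1 (w e.2.1) + x e.2.2.1 (w e.2.2.1) = e.2.2.2 then 0 else 1

/-- A column is the sum of the violation indicators, shifted. -/
theorem col_eq_sum (F : Finset (Pool m)) (ε : ℝ) (w : Fin m → Fin t)
    (x : Fin m → Fin t → ZMod 2) : col F ε w x = (∑ e ∈ F, vInd e w x) - ε := by
  unfold col vInd viol
  rw [Finset.card_filter]
  push_cast
  congr 1
  refine sum_congr rfl fun e _ => ?_
  by_cases h : x e.1 (w e.1) + x e.2.1 (w e.2.1) + x e.2.2.1 (w e.2.2.1) = e.2.2.2 <;> simp [Sat, h]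

/-- The character functional `Λ_{w₀}(f) = Σ_x χ(x) f(x)`. -/
def Lam (i j l : Fin m) (w₀ : Fin m → Fin t) (f : (Fin m → Fin t → ZMod 2) → ℝ) : ℝ :=
  ∑ x, chi i j l w₀ x * f x

/-- A column whose pointer misses the bit `(a, w₀ a)` is invariant under flipping that bit. -/
theorem col_flip_of_ne (F : Finset (Pool m)) (ε : ℝ) {w w₀ : Fin m → Fin t} {a : Fin m}
    (hw : w a ≠ w₀ a) (x : Fin m → Fin t → ZMod 2) :
    col F ε w (flipAt a (w₀ a) x) = col F ε w x := by
  unfold col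
  have : (fun i => flipAt a (w₀ a) x i (w i)) = fun i => x i (w i) := by
    funext b
    rw [flipAt_read, if_neg, add_zero]
    rintro ⟨rfl, h⟩
    exact hw h
  rw [this]

/-- **Off-diagonal vanishing.** `Λ_{w₀}(col w) = 0` as soon as `w` and `w₀` disagree on one of `i, j, l`. -/
theorem Lam_col_eq_zero {i j l : Fin m} (hij : i ≠ j) (hil : i ≠ l) (hjl : j ≠ l)
    (F : Finset (Pool m)) (ε : ℝ) {w w₀ : Fin m → Fin t} {a : Fin m} (ha : a = i ∨ a = j ∨ a = l)
    (hw : w a ≠ w₀ a) : Lam i j l w₀ (col F ε w) = 0 :=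
  sum_mul_eq_zero_of_flip a (w₀ a) _ _ (chi_flip hij hil hjl w₀ ha) (col_flip_of_ne F ε hw)

/-- The index set of an equation. -/
def idx (e : Pool m) : Finset (Fin m) := {e.1, e.2.1, e.2.2.1}

/-- An equation has at most three indices. -/
theorem card_idx_le (e : Pool m) : (idx e).card ≤ 3 := Finset.card_le_three

/-- Three distinct indices form a set of size three. -/
theorem card_triple {i j l : Fin m} (hij : i ≠ j) (hil : i ≠ l) (hjl : j ≠ l) :
    ({i, j, l} : Finset (Fin m)).card = 3 := by
  rw [Finset.card_insert_of_notMem, Finset.card_insert_of_notMem, Finset.card_singleton]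
  · simpa using hjl
  · simp only [Finset.mem_insert, Finset.mem_singleton, not_or]
    exact ⟨hij, hil⟩

/-- An equation NOT exactly on `{i, j, l}` misses one of the three indices. -/
theorem exists_not_mem_idx {i j l : Fin m} (hij : i ≠ j) (hil : i ≠ l) (hjl : j ≠ l) {e : Pool m}
    (he : idx e ≠ {i, j, l}) : ∃ a, (a = i ∨ a = j ∨ a = l) ∧ a ∉ idx e := by
  by_contra hcon
  push Not at hcon
  have hsub : ({i, j, l} : Finset (Fin m)) ⊆ idx e := by
    intro a ha
    simp only [Finset.mem_insert, Finset.mem_singleton] at ha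
    exact hcon a ha
  have h := Finset.eq_of_subset_of_card_le hsub (by rw [card_triple hij hil hjl]; exact card_idx_le e)
  exact he h.symm

/-- The three indices of an equation whose index set has three elements are distinct. -/
theorem distinct_of_card_idx {e : Pool m} (h : (idx e).card = 3) :
    e.1 ≠ e.2.1 ∧ e.1 ≠ e.2.2.1 ∧ e.2.1 ≠ e.2.2.1 := by
  have key : ∀ a b : Fin m, ¬ (idx e ⊆ {a, b}) := fun a b hs => by
    have := (Finset.card_le_card hs).trans Finset.card_le_two
    omega
  refine ⟨fun h12 => key e.2.1 e.2.2.1 ?_, fun h13 => key e.2.1 e.2.2.1 ?_, fun h23 => key e.1 e.2.2.1 ?_⟩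
  all_goals
    intro b hb
    simp only [idx, Finset.mem_insert, Finset.mem_singleton] at hb ⊢
    rcases hb with hb | hb | hb <;> simp_all

/-- The violation indicator of an equation missing index `a` is invariant under flipping a bit of
block `a`. -/
theorem vInd_flip_of_not_mem {e : Pool m} {a : Fin m} (ha : a ∉ idx e) (k : Fin t)
    (w : Fin m → Fin t) (x : Fin m → Fin t → ZMod 2) : vInd e w (flipAt a k x) = vInd e w x := by
  unfold vInd
  simp only [idx, Finset.mem_insert, Finset.mem_singleton, not_or] at ha
  rw [flipAt_read, flipAt_read, flipAt_read,
    if_neg (show ¬ (e.1 = a ∧ w e.1 = k) from fun h => ha.1 h.1.symm),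
    if_neg (show ¬ (e.2.1 = a ∧ w e.2.1 = k) from fun h => ha.2.1 h.1.symm),
    if_neg (show ¬ (e.2.2.1 = a ∧ w e.2.2.1 = k) from fun h => ha.2.2 h.1.symm),
    add_zero, add_zero, add_zero]

/-- For an equation exactly on `{i, j, l}`, the violation indicator read through `w₀` is a function of
the parity `par i j l w₀`. -/
theorem vInd_eq_of_idx_eq {i j l : Fin m} (hij : i ≠ j) (hil : i ≠ l) (hjl : j ≠ l) {e : Pool m}
    (he : idx e = {i, j, l}) (w₀ : Fin m → Fin t) (x : Fin m → Fin t → ZMod 2) :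
    vInd e w₀ x = if par i j l w₀ x = e.2.2.2 then 0 else 1 := by
  have hce : (idx e).card = 3 := by rw [he, card_triple hij hil hjl]
  obtain ⟨hd12, hd13, hd23⟩ := distinct_of_card_idx hce
  have hsum_e : x e.1 (w₀ e.1) + x e.2.1 (w₀ e.2.1) + x e.2.2.1 (w₀ e.2.2.1) =
      ∑ b ∈ idx e, x b (w₀ b) := by
    unfold idx
    rw [Finset.sum_insert (by simp [hd12, hd13]), Finset.sum_insert (by simp [hd23]),
      Finset.sum_singleton]
    ring
  have hsum_ijl : par i j l w₀ x = ∑ b ∈ ({i, j, l} : Finset (Fin m)), x b (w₀ b) := by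
    unfold par
    rw [Finset.sum_insert (by simp [hij, hil]), Finset.sum_insert (by simp [hjl]),
      Finset.sum_singleton]
    ring
  unfold vInd
  rw [hsum_e, he, ← hsum_ijl]

/-! ## §4 The diagonal value is non-zero -/

/-! The hypotheses on the triple used below ("good triple"): `i, j, l` distinct, `F` has an equation exactly
on `{i,j,l}` (`hex`), and all such equations have the same right-hand side (`hrhs`). -/

/-- **Diagonal non-vanishing.** For a good triple, `Λ_{w₀}(col w₀) ≠ 0` for every pointer `w₀` and
every real shift `ε`. -/
theorem Lam_col_self_ne_zero {F : Finset (Pool m)} {i j l : Fin m} (hij : i ≠ j) (hil : i ≠ l)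
    (hjl : j ≠ l) (hex : ∃ e ∈ F, idx e = {i, j, l})
    (hrhs : ∀ e ∈ F, ∀ e' ∈ F, idx e = {i, j, l} → idx e' = {i, j, l} → e.2.2.2 = e'.2.2.2)
    (ε : ℝ) (w₀ : Fin m → Fin t) : Lam i j l w₀ (col F ε w₀) ≠ 0 := by
  obtain ⟨e₀, he₀F, he₀⟩ := hex
  -- expand the functional
  have hexp : Lam i j l w₀ (col F ε w₀) =
      ∑ e ∈ F, ∑ x, chi i j l w₀ x * vInd e w₀ x - ε * ∑ x, chi i j l w₀ x := by
    unfold Lam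
    simp only [col_eq_sum, mul_sub, Finset.sum_sub_distrib, Finset.mul_sum]
    rw [Finset.sum_comm]
    congr 1
    refine Finset.sum_congr rfl fun x _ => ?_
    ring
  rw [hexp, sum_chi_eq_zero hij hil hjl w₀, mul_zero, sub_zero]
  -- equations not exactly on the triple contribute zero
  have hsplit : ∑ e ∈ F, ∑ x, chi i j l w₀ x * vInd e w₀ x =
      ∑ e ∈ F.filter (fun e => idx e = {i, j, l}), ∑ x, chi i j l w₀ x * vInd e w₀ x := by
    rw [Finset.sum_filter]
    refine Finset.sum_congr rfl fun e _ => ?_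
    split_ifs with he
    · rfl
    · obtain ⟨a, ha, hae⟩ := exists_not_mem_idx hij hil hjl he
      exact sum_mul_eq_zero_of_flip a (w₀ a) _ _ (chi_flip hij hil hjl w₀ ha)
        (vInd_flip_of_not_mem hae (w₀ a) w₀)
  rw [hsplit]
  -- on the triple every term equals the same value `T₀`
  set β : ZMod 2 := e₀.2.2.2 with hβ
  set T₀ : ℝ := ∑ x, chi i j l w₀ x * (if par i j l w₀ x = β then 0 else 1) with hT₀
  have hterm : ∀ e ∈ F.filter (fun e => idx e = {i, j, l}),
      ∑ x, chi i j l w₀ x * vInd e w₀ x = T₀ := by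
    intro e he
    rw [Finset.mem_filter] at he
    have hrr : e.2.2.2 = β := hrhs e he.1 e₀ he₀F he.2 he₀
    refine Finset.sum_congr rfl fun x _ => ?_
    rw [vInd_eq_of_idx_eq hij hil hjl he.2 w₀ x, hrr]
  rw [Finset.sum_congr rfl hterm, Finset.sum_const, nsmul_eq_mul]
  have hcard : 0 < (F.filter (fun e => idx e = {i, j, l})).card :=
    Finset.card_pos.2 ⟨e₀, Finset.mem_filter.2 ⟨he₀F, he₀⟩⟩
  have hcardR : (0 : ℝ) < (F.filter (fun e => idx e = {i, j, l})).card := by exact_mod_cast hcard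
  suffices hT : T₀ ≠ 0 from mul_ne_zero hcardR.ne' hT
  -- two witnesses: the zero table (parity 0) and the table with a single one (parity 1)
  let x0 : Fin m → Fin t → ZMod 2 := fun _ _ => 0
  have hx0 : par i j l w₀ x0 = 0 := by simp [par, x0]
  have hx1 : par i j l w₀ (flipAt i (w₀ i) x0) = 1 := by
    rw [par_flip hij hil hjl w₀ (Or.inl rfl), hx0, zero_add]
  rcases zmod2_cases β with hb | hb
  · -- β = 0: every term is `≤ 0` and the term at the one-bit table is `-1`
    have hle : ∀ x, chi i j l w₀ x * (if par i j l w₀ x = β then 0 else 1) ≤ 0 := by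
      intro x
      unfold chi
      rcases zmod2_cases (par i j l w₀ x) with h | h <;> simp [h, hb]
    have hlt : 0 < -T₀ := by
      rw [hT₀, ← Finset.sum_neg_distrib]
      calc (0 : ℝ) < ∑ x ∈ {flipAt i (w₀ i) x0},
            -(chi i j l w₀ x * (if par i j l w₀ x = β then 0 else 1)) := by
            rw [Finset.sum_singleton]
            unfold chi
            rw [hx1, hb]
            simp
        _ ≤ ∑ x, -(chi i j l w₀ x * (if par i j l w₀ x = β then 0 else 1)) :=
            Finset.sum_le_sum_of_subset_of_nonneg (Finset.subset_univ _)
              (fun x _ _ => neg_nonneg.2 (hle x))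
    have : T₀ < 0 := by linarith
    exact this.ne
  · -- β = 1: every term is `≥ 0` and the term at the zero table is `1`
    have hge : ∀ x, 0 ≤ chi i j l w₀ x * (if par i j l w₀ x = β then 0 else 1) := by
      intro x
      unfold chi
      rcases zmod2_cases (par i j l w₀ x) with h | h <;> simp [h, hb]
    have hgt : 0 < T₀ := by
      rw [hT₀]
      calc (0 : ℝ) < ∑ x ∈ {x0}, chi i j l w₀ x * (if par i j l w₀ x = β then 0 else 1) := by
            rw [Finset.sum_singleton]
            unfold chi
            rw [hx0, hb]
            simp
        _ ≤ ∑ x, chi i j l w₀ x * (if par i j l w₀ x = β then 0 else 1) :=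
            Finset.sum_le_sum_of_subset_of_nonneg (Finset.subset_univ _) (fun x _ _ => hge x)
    exact hgt.ne'

/-! ## §5 Pointers through a triple -/

/-- The pointer taking the values `π` on the blocks `i, j, l` and `π.1` elsewhere. -/
def ptrOf (i j l : Fin m) (π : Fin t × Fin t × Fin t) : Fin m → Fin t :=
  fun b => if b = i then π.1 else if b = j then π.2.1 else if b = l then π.2.2 else π.1

/-- Value of `ptrOf` on block `i`. -/
theorem ptrOf_i (i j l : Fin m) (π : Fin t × Fin t × Fin t) : ptrOf i j l π i = π.1 := by
  simp [ptrOf]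

/-- Value of `ptrOf` on block `j`. -/
theorem ptrOf_j {i j l : Fin m} (hij : i ≠ j) (π : Fin t × Fin t × Fin t) :
    ptrOf i j l π j = π.2.1 := by
  simp [ptrOf, hij.symm]

/-- Value of `ptrOf` on block `l`. -/
theorem ptrOf_l {i j l : Fin m} (hil : i ≠ l) (hjl : j ≠ l) (π : Fin t × Fin t × Fin t) :
    ptrOf i j l π l = π.2.2 := by
  simp [ptrOf, hil.symm, hjl.symm]

/-- Distinct triples give pointers that disagree on one of `i, j, l`. -/
theorem exists_ptrOf_ne {i j l : Fin m} (hij : i ≠ j) (hil : i ≠ l) (hjl : j ≠ l)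
    {π π' : Fin t × Fin t × Fin t} (hne : π' ≠ π) :
    ∃ a, (a = i ∨ a = j ∨ a = l) ∧ ptrOf i j l π' a ≠ ptrOf i j l π a := by
  by_contra hcon
  push Not at hcon
  apply hne
  have h1 := hcon i (Or.inl rfl)
  have h2 := hcon j (Or.inr (Or.inl rfl))
  have h3 := hcon l (Or.inr (Or.inr rfl))
  rw [ptrOf_i, ptrOf_i] at h1
  rw [ptrOf_j hij, ptrOf_j hij] at h2
  rw [ptrOf_l hil hjl, ptrOf_l hil hjl] at h3
  exact Prod.ext h1 (Prod.ext h2 h3)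

/-! ## §6 Registered form: the character sums are a dual family to the columns -/

/-- The character depends only on the three selected pointer values. -/
theorem chi_congr {i j l : Fin m} {w₀ w : Fin m → Fin t} (hi : w i = w₀ i) (hj : w j = w₀ j)
    (hl : w l = w₀ l) : chi i j l w = chi i j l w₀ := by
  funext x
  simp [chi, par, hi, hj, hl]

/-- **Dual family (registered sub-goal `character_dual_family` of stmt-PneNP-10680; def-free form of
`Lam_col_eq_zero` + `Lam_col_self_ne_zero`).** Let `F` have an equation exactly on the distinct triple
`{i, j, l}`, all such equations sharing their right-hand side. Then for every real `ε` and all pointers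
`w₀, w`, the character sum `Σ_x χ_{w₀}(x) · (viol_F(x[w]) − ε)` over string tables vanishes if and only if
`w` and `w₀` disagree on one of the blocks `i, j, l`. -/
theorem character_dual_family : ∀ {m t : ℕ} (F : Finset (Pool m)) {i j l : Fin m}, i ≠ j → i ≠ l →
    j ≠ l → (∃ e ∈ F, ({e.1, e.2.1, e.2.2.1} : Finset (Fin m)) = {i, j, l}) →
    (∀ e ∈ F, ∀ e' ∈ F, ({e.1, e.2.1, e.2.2.1} : Finset (Fin m)) = {i, j, l} →
      ({e'.1, e'.2.1, e'.2.2.1} : Finset (Fin m)) = {i, j, l} → e.2.2.2 = e'.2.2.2) →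
    ∀ (ε : ℝ) (w₀ w : Fin m → Fin t),
      (∑ x : Fin m → Fin t → ZMod 2,
          (if x i (w₀ i) + x j (w₀ j) + x l (w₀ l) = 0 then (1 : ℝ) else -1) *
            ((viol F (fun b => x b (w b)) : ℝ) - ε)) = 0 ↔
        ¬ (w i = w₀ i ∧ w j = w₀ j ∧ w l = w₀ l) := by
  intro m t F i j l hij hil hjl hex hrhs ε w₀ w
  show Lam i j l w₀ (col F ε w) = 0 ↔ _
  constructor
  · rintro h ⟨hi, hj, hl⟩
    apply Lam_col_self_ne_zero hij hil hjl hex hrhs ε w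
    unfold Lam at h ⊢
    rw [chi_congr hi hj hl]
    exact h
  · intro h
    by_cases hi : w i = w₀ i
    · by_cases hj : w j = w₀ j
      · have hl : w l ≠ w₀ l := fun hl => h ⟨hi, hj, hl⟩
        exact Lam_col_eq_zero hij hil hjl F ε (Or.inr (Or.inr rfl)) hl
      · exact Lam_col_eq_zero hij hil hjl F ε (Or.inr (Or.inl rfl)) hj
    · exact Lam_col_eq_zero hij hil hjl F ε (Or.inl rfl) hi

end

end Summit.PneNP.PneNP.Theorems.XorDoor.RankCorner
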